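import Literature.AnabelianGeometry.SemiGraphs.TemperedDecompositionSubgroupsProfinitelyClosed
import HarnessLib

/-!
# Closed range of a continuous homomorphism of TEMPERED groups along which open normal subgroups pull back
# cofinally — the closedness residual of [IUTchI] Cor. 2.3 (v) for decomposition subgroups

Mochizuki, *Semi-graphs of anabelioids*, Publ. RIMS **42** (2006), Def. 3.1 (i) p. 33 (tempered groups: "an
inverse limit of an inverse system of surjections of countable discrete topological groups"; the tree's
intrinsic `IsTempered`: basis / separated / complete) [cite: MochizukiSemiAnbd2006, Def 3.1(i) p.33]; Mochizuki,
*Inter-universal Teichmüller theory I*, §2, Cor. 2.3 (v) pp. 48–50 [cite: Mochizuki2012, IUTchI Cor 2.3(v) pp.49-50]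
(`[claim: Mochizuki2012, status: disputed]`; nothing of the series is asserted).

PROOF-ONLY file (abc-iut cell, layer L3, row «DECOMP-PROFINITE» sequel = sub-row (P1) of GAP row G-w5d028-2,
seat abc-iut-w5-d240 gen 6; no definition, no instance, no new named fact).  `TemperedDecompositionSubgroupsProfinitelyClosed.lean` proved (P1) «`ι⁻¹(closure ι(Π^tp_ℍ)) =
Π^tp_ℍ`» modulo CLOSEDNESS of `Π^tp_ℍ = range φ` in `π₁^temp(𝒢)`.  Here closedness is reduced to COFINALITY:

* `IsTempered.isClosed_range_of_comap_cofinal` — for a continuous homomorphism `φ : Γ' → Γ` of tempered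
  groups such that every open normal subgroup of `Γ'` contains `φ⁻¹(N)` for some open normal `N ≤ Γ`,
  `range φ` is CLOSED: a point `x` of the closure gives approximations `φ(y_N) ≡ x (mod N)`, canonical
  modulo `φ⁻¹(N)`, hence (cofinality) a compatible family of cosets of `Γ'`; COMPLETENESS of `Γ'` gives
  `g`, SEPARATEDNESS of `Γ` gives `φ g = x`;
* `TemperedPiChart.isClosed_range_of_comap_cofinal`, **`comap_topologicalClosure_map_range_eq_of_isDecompHom_of_cofinal`**
  — at a decomposition homomorphism of a sub-semi-graph: (P1) with the residual now DISPLAYED AS COFINALITY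
  «every open normal subgroup of `π₁^temp(𝒢_ℍ)` contains the pull-back of one of `π₁^temp(𝒢)`» (in covering
  language: every tempered covering of `𝒢_ℍ` is dominated over the base point by the restriction to `ℍ` of a
  tempered covering of `𝒢` — the tempered analogue of [SemiAnbd] Prop. 2.5 (i), `proposition_2_5_i_holds`).

HONEST RESIDUAL: that cofinality (the decomposition homomorphism is a topological embedding on open normal
subgroups).  Nothing here takes a side on [IUTchIII] Cor. 3.12.
-/

namespace Literature.AnabelianGeometry.SemiGraphs

open Topology

universe u v

section ClosedRange

variable {Γ' : Type u} [Group Γ'] [TopologicalSpace Γ']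
  {Γ : Type v} [Group Γ] [TopologicalSpace Γ] [IsTopologicalGroup Γ]



/-- In the closure of the range: for every open normal `N`, some `φ y` with `(φ y)⁻¹ x ∈ N`. [folklore] -/
private theorem exists_inv_mul_mem_of_mem_closure (φ : Γ' →ₜ* Γ) {x : Γ}
    (hx : x ∈ closure (Set.range φ)) (N : OpenNormalSubgroup Γ) :
    ∃ y : Γ', (φ y)⁻¹ * x ∈ N.toSubgroup := by
  have hO : IsOpen {z : Γ | z⁻¹ * x ∈ (N : Set Γ)} :=
    N.isOpen'.preimage ((continuous_id.inv).mul continuous_const)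
  obtain ⟨z, hz, ⟨y, rfl⟩⟩ := mem_closure_iff.1 hx _ hO (by simp)
  exact ⟨y, hz⟩

omit [IsTopologicalGroup Γ] in
/-- Two approximations modulo the same open normal subgroup differ by an element of its pull-back. [folklore] -/
private theorem inv_mul_mem_comap (φ : Γ' →ₜ* Γ) {x : Γ} (N : OpenNormalSubgroup Γ) {y₁ y₂ : Γ'}
    (h₁ : (φ y₁)⁻¹ * x ∈ N.toSubgroup) (h₂ : (φ y₂)⁻¹ * x ∈ N.toSubgroup) :
    y₁⁻¹ * y₂ ∈ N.toSubgroup.comap φ.toMonoidHom := by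
  rw [Subgroup.mem_comap]
  have : φ.toMonoidHom (y₁⁻¹ * y₂) = ((φ y₁)⁻¹ * x) * ((φ y₂)⁻¹ * x)⁻¹ := by
    rw [map_mul, map_inv]; change (φ y₁)⁻¹ * φ y₂ = _; group
  rw [this]
  exact N.toSubgroup.mul_mem h₁ (N.toSubgroup.inv_mem h₂)

/-- **Closed range from COFINALITY of pulled-back open normal subgroups.**  Let `φ : Γ' → Γ` be a continuous
homomorphism of TEMPERED groups ([SemiAnbd] Def. 3.1 (i): complete, separated, open normal subgroups a
basis) such that every open normal subgroup of `Γ'` contains `φ⁻¹(N)` for some open normal `N ≤ Γ` (the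
topology of `Γ'` on open normal subgroups is induced along `φ`).  Then `range φ` is CLOSED in `Γ`: a point
of the closure yields a compatible family of cosets of `Γ'` (canonical modulo each `φ⁻¹ N`), completeness
of `Γ'` gives a preimage, separatedness of `Γ` identifies its image. [cite: MochizukiSemiAnbd2006, Def 3.1(i) p.33] -/
theorem IsTempered.isClosed_range_of_comap_cofinal (hΓ' : IsTempered Γ') (hΓ : IsTempered Γ)
    (φ : Γ' →ₜ* Γ)
    (hcof : ∀ N' : OpenNormalSubgroup Γ', ∃ N : OpenNormalSubgroup Γ,
      N.toSubgroup.comap φ.toMonoidHom ≤ N'.toSubgroup) :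
    IsClosed (Set.range φ) := by
  classical
  refine isClosed_of_closure_subset fun x hx => ?_
  choose Nof hNof using hcof
  choose y hy using fun N : OpenNormalSubgroup Γ => exists_inv_mul_mem_of_mem_closure φ hx N
  -- comparison of two approximations through a common refinement
  have hcmp : ∀ N M : OpenNormalSubgroup Γ,
      (y N)⁻¹ * y (N ⊓ M) ∈ N.toSubgroup.comap φ.toMonoidHom ∧
        (y (N ⊓ M))⁻¹ * y M ∈ M.toSubgroup.comap φ.toMonoidHom := fun N M =>
    ⟨inv_mul_mem_comap φ N (hy N) (hy (N ⊓ M)).1,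
      inv_mul_mem_comap φ M (hy (N ⊓ M)).2 (hy M)⟩
  -- the compatible family of cosets `N' ↦ [y (Nof N')]` and its limit `g`
  obtain ⟨g, hg⟩ := hΓ'.complete (fun N' => (y (Nof N') : Γ' ⧸ N'.toSubgroup)) (by
    intro N' M' hle g hgN'
    obtain ⟨h13, h32⟩ := hcmp (Nof N') (Nof M')
    have h13' : (y (Nof N'))⁻¹ * y ((Nof N' ⊓ Nof M')) ∈ N'.toSubgroup := hNof N' h13
    have h32' : (y ((Nof N' ⊓ Nof M')))⁻¹ * y (Nof M') ∈ M'.toSubgroup := hNof M' h32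
    have hgN'' : (y (Nof N'))⁻¹ * g ∈ N'.toSubgroup := QuotientGroup.eq.1 hgN'
    rw [QuotientGroup.eq]
    have : (y (Nof M'))⁻¹ * g = ((y ((Nof N' ⊓ Nof M')))⁻¹ * y (Nof M'))⁻¹ *
        (((y (Nof N'))⁻¹ * y ((Nof N' ⊓ Nof M')))⁻¹ * ((y (Nof N'))⁻¹ * g)) := by group
    rw [this]
    exact M'.toSubgroup.mul_mem (M'.toSubgroup.inv_mem h32')
      (hle (N'.toSubgroup.mul_mem (N'.toSubgroup.inv_mem h13') hgN'')))
  -- `(φ g)⁻¹ x` lies in every open normal subgroup of `Γ`, hence `φ g = x` (separatedness)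
  have key : ∀ N : OpenNormalSubgroup Γ, (φ g)⁻¹ * x ∈ N.toSubgroup := by
    intro N
    let N' : OpenNormalSubgroup Γ' :=
      { toSubgroup := N.toSubgroup.comap φ.toMonoidHom
        isOpen' := N.isOpen'.preimage φ.continuous
        isNormal' := Subgroup.Normal.comap inferInstance _ }
    have hgN : (y (Nof N'))⁻¹ * g ∈ N.toSubgroup.comap φ.toMonoidHom := QuotientGroup.eq.1 (hg N')
    obtain ⟨h14, -⟩ := hcmp (Nof N') N
    have h14' : (y (Nof N'))⁻¹ * y ((Nof N' ⊓ N)) ∈ N.toSubgroup.comap φ.toMonoidHom := hNof N' h14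
    have h4 : (φ (y ((Nof N' ⊓ N))))⁻¹ * x ∈ N.toSubgroup := (hy ((Nof N' ⊓ N))).2
    rw [Subgroup.mem_comap] at hgN h14'
    have : (φ g)⁻¹ * x = (φ.toMonoidHom ((y (Nof N'))⁻¹ * g))⁻¹ *
        (φ.toMonoidHom ((y (Nof N'))⁻¹ * y ((Nof N' ⊓ N))) *
          ((φ (y ((Nof N' ⊓ N))))⁻¹ * x)) := by
      simp only [map_mul, map_inv]
      change _ = ((φ (y (Nof N')))⁻¹ * φ g)⁻¹ * (((φ (y (Nof N')))⁻¹ * φ (y ((Nof N' ⊓ N)))) *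
        ((φ (y ((Nof N' ⊓ N))))⁻¹ * x))
      group
    rw [this]
    exact N.toSubgroup.mul_mem (N.toSubgroup.inv_mem hgN) (N.toSubgroup.mul_mem h14' h4)
  refine ⟨g, ?_⟩
  by_contra hne
  have hne' : (φ g)⁻¹ * x ≠ 1 := fun h => hne (inv_mul_eq_one.1 h)
  obtain ⟨N, hN⟩ := hΓ.separated _ hne'
  exact hN (key N)

end ClosedRange

/-! ### At the decomposition subgroups of a sub-semi-graph -/

namespace ProfiniteSemiGraph

namespace TemperedPiChart

variable {𝒢 : ProfiniteSemiGraph.{u}}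

/-- **Decomposition subgroups are closed, given cofinality**: for charts `c` of `π₁^temp(𝒢)`, `c'` of
`π₁^temp(𝒢_ℍ)` and a continuous `φ : c'.G → c.G` along which the open normal subgroups of `π₁^temp(𝒢)` pull
back COFINALLY into those of `π₁^temp(𝒢_ℍ)` (every tempered covering of `𝒢_ℍ` is dominated, over the base
point, by the restriction of one of `𝒢`), `range φ = Π^tp_ℍ` is closed in `π₁^temp(𝒢)` (both groups are
tempered, `TemperedPiChart.isTempered`). [cite: MochizukiSemiAnbd2006, Prop 3.6(ii) p.38] -/
theorem isClosed_range_of_comap_cofinal {H : 𝒢.graph.Subgraph} (c : TemperedPiChart 𝒢)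
    (c' : TemperedPiChart (𝒢.restrict H)) (φ : c'.G →ₜ* c.G)
    (hcof : ∀ N' : OpenNormalSubgroup c'.G, ∃ N : OpenNormalSubgroup c.G,
      N.toSubgroup.comap φ.toMonoidHom ≤ N'.toSubgroup) :
    IsClosed ((φ.toMonoidHom.range : Subgroup c.G) : Set c.G) := by
  haveI := c.isTopologicalGroup
  rw [MonoidHom.coe_range]
  exact c'.isTempered.isClosed_range_of_comap_cofinal c.isTempered φ hcof

/-- **[IUTchI] Cor. 2.3 (v) for a decomposition subgroup, with the closedness residual replaced by
COFINALITY**: `𝒢`, `𝒢_ℍ` finite coherent Prop-3.6 graphs, `𝒢` with a closed edge, `φ : π₁^temp(𝒢_ℍ) →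
π₁^temp(𝒢)` a decomposition homomorphism (`IsDecompHom`) along which open normal subgroups pull back
cofinally; then for ANY profinite completion `ι` of `π₁^temp(𝒢)`: `ι⁻¹(closure ι(Π^tp_ℍ)) = Π^tp_ℍ` with
`Π^tp_ℍ := range φ`.  The [IUTchI] sentence is a `[claim: Mochizuki2012, status: disputed]` item; PROVED is
the displayed statement. [cite: Mochizuki2012, IUTchI Cor 2.3(v) pp.49-50] -/
theorem comap_topologicalClosure_map_range_eq_of_isDecompHom_of_cofinal {H : 𝒢.graph.Subgraph}
    [Finite 𝒢.graph.Vertex] [Finite 𝒢.graph.Edge] [Finite (𝒢.restrict H).graph.Vertex]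
    [Finite (𝒢.restrict H).graph.Edge] (h36 : 𝒢.Prop36Hypotheses) (hcoh : 𝒢.IsCoherent)
    (hcl : ∃ e : 𝒢.graph.Edge, 𝒢.graph.IsClosedEdge e) (h36' : (𝒢.restrict H).Prop36Hypotheses)
    (hcoh' : (𝒢.restrict H).IsCoherent) (c : TemperedPiChart 𝒢) (c' : TemperedPiChart (𝒢.restrict H))
    {φ : c'.G →ₜ* c.G} (hφ : c.IsDecompHom H c' φ)
    (hcof : ∀ N' : OpenNormalSubgroup c'.G, ∃ N : OpenNormalSubgroup c.G,
      N.toSubgroup.comap φ.toMonoidHom ≤ N'.toSubgroup)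
    {P : Type v} [Group P] [TopologicalSpace P] [IsTopologicalGroup P] {ι : c.G →ₜ* P}
    (hι : IsProfiniteCompletion ι) :
    (((φ.toMonoidHom.range).map ι.toMonoidHom).topologicalClosure).comap ι.toMonoidHom =
      φ.toMonoidHom.range :=
  comap_topologicalClosure_map_eq_of_mem_decompSubgroups_of_isClosed h36 hcoh hcl h36' hcoh' c hι
    hφ.range_mem (isClosed_range_of_comap_cofinal c c' φ hcof)

end TemperedPiChart

end ProfiniteSemiGraph

end Literature.AnabelianGeometry.SemiGraphs
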